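import Summits.QuantumFields.BalabanUV.T4Continuum.Spine.NE3.PairLandauB8
import Summits.QuantumFields.BalabanUV.T4Continuum.Support.NE3GaugeDirFrames
import HarnessLib

/-!
# T⁴ programme, node NE3 (pub-ymgap DAG node N16) — THE END's (1.38) IN PRINT's FORM: `IsLandauB8 L N k W Z` ⟺ «the covariant divergence
# of `Z` is `ℓ²(torus)`-orthogonal to `Δ_W N(Q′(W))`» (`isLandauB8_iff_covDiv`), and in the left chart `Z = Ad_{W⁻¹}Y` (`Y = iηA`):
# `covDiv W Z = cdiv W Y`, so (1.38) reads «`D*_{W}Y ⊥ Δ_W N(Q′(W))`» = «`R(W)D*_{W}A = 0`» for `R(W)` the orthogonal projection onto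
# `Δ_W N(Q′(W))` (B8 p. 80) (`PairLandauDivB8`)

Cell `pub-ymgap`, HUMAN RULING D-0062, seat `pub-ymgap-dag-n16-b` (FIRST-MISSING-ESTIMATE for N16 = NE3; writer prover-pub-ymgap-dag-n16-b-g2-0,
2026-08-26).  Companion of `Spine/NE3/PairLandauB8` ((1.38) variational: `IsLandauB8`), `Spine/NE3/AvgKernelQprimeB8` (`N(Q′(W))` = `ker Q′_k(W)` by
name) and `Spine/NE3/PairLeftChartB8` (left chart ↔ END frame).

WHY.  [Balaban1985RegularSpaces] p. 80 defines `R(U₀)` as «an orthogonal projection in the Hilbert space of 𝔤-valued functions … onto the subspace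
Δ^η_{U₀}N(Q′(U₀))» and (1.38) is «R(U₀)D^{η*}_{U₀}A = 0».  For an orthogonal projection, `R v = 0 ⟺ v ⊥ range R`; so (1.38) SAYS: the covariant
divergence `D^{η*}_{U₀}A` is `ℓ²`-orthogonal to `Δ_{U₀}μ` for every `μ ∈ N(Q′(U₀))`.  THE END's `IsLandauB8 L N k W Z` says: `Z ⊥ gaugeDir W (Δ_W μ)`
for every `μ ∈ avgKernelGauges L N k W`.  This file proves the two are ONE statement up to the (not yet constructed, N05's) projection `R(U₀)`:
the END's clause is, by the periodic summation by parts of the lineage (`NE3LandauOrbit.sum_hsR_gaugeDir`, [Balaban1985Variational] (83)),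
`Σ_x hsR (covDiv W Z x) (Δ_W μ x) = 0`, and for `Z = Ad_{W⁻¹}Y` the END-frame divergence `covDiv W Z` IS the start-frame divergence
`NE3CovariantCalculus.cdiv W Y` of the left-chart field ((1.2) TYPE «D^{η*}_U» on 1-forms, unit lattice).

WHAT ([folklore]; 0 def, 0 sorry):
* `covLapSite_periodic` — `Δ_W μ` is periodic for periodic `W, μ`;
* **`isLandauB8_iff_covDiv`** — for unitary `(N·Lᵏ)`-periodic `W`, `(N·Lᵏ)`-periodic `Z`, `N·Lᵏ ≥ 1`:
  `IsLandauB8 L N k W Z ↔ ∀ μ ∈ avgKernelGauges L N k W, Σ_{x ∈ periodBox (N·Lᵏ)} hsR (covDiv W Z x) (covLapSite W μ x) = 0`;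
* `covDiv_AdInv_eq_cdiv` — `covDiv W (Ad_{W⁻¹}Y) = cdiv W Y`;
* **`isLandauB8_AdInv_iff_cdiv`** — the left-chart reading: `IsLandauB8 L N k W (Ad_{W⁻¹}Y) ↔ ∀ μ ∈ N(Q′(W)), Σ_x hsR (cdiv W Y x) (Δ_W μ x) = 0`.
HONEST FRAMING (page 1): a dictionary; `R(U₀)` (the projection) is NOT constructed here — the last step «`v ⊥ range R ⟺ Rv = 0`» waits for N05's
object; (1.38) for Bałaban's minimisers is [B8] Thm 4 (N05's, NOT proved); Thm 2 ∕ NE3 NOT proved; spine 0∕9; finite T⁴ rung (B)+1 at fixed ε —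
NOT infinite volume, NOT mass gap, NOT `BetaPertH`, NOT Clay.  PLACEMENT: `Spine/NE3/`.
-/

set_option autoImplicit false

open scoped BigOperators Matrix Matrix.Norms.L2Operator
open NormedSpace

namespace Summit.QuantumFields.BalabanUV.T4Continuum.NE3.PairLandauDivB8

open Literature.MathematicalPhysics.QuantumFieldTheory.Balaban1983to89
open B7Prop1Explicit B7Prop2Explicit
open T4AveragingDeficitWall (IsUnitaryCfg Ad)
open T4AveragingDeficitWallBoundary (periodBox IsPeriodicCfg)
open AveragingDeficitPeriodicCounting (IsPeriodicDir)
open BlockAveragePushDirGauge (gaugeDir)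
open NE3CovariantCalculus (hsR cD cDstar cdiv cD_periodic cDstar_periodic)
open NE3CovariantWeitzenbock (covDiv)
open NE3LandauOrbit (sum_hsR_gaugeDir)
open NE3GaugeDirFrames (Ad_Ad_inv)
open NE3.PairLandauB8 (avgKernelGauges mem_avgKernelGauges_iff covLapSite IsLandauB8)

noncomputable section

variable {d : ℕ} {n : Type*} [Fintype n] [DecidableEq n]

/-- `Δ_W μ` is `P`-periodic for `P`-periodic `W` and `μ`. [folklore] -/
theorem covLapSite_periodic {P : ℕ} {W : Site d → Fin d → (Matrix n n ℂ)ˣ} (hWP : IsPeriodicCfg W (P : ℤ)) {mu : Site d → Matrix n n ℂ}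
    (hmu : ∀ (x : Site d) (κ : Fin d), mu (x + (P : ℤ) • e κ) = mu x) (x : Site d) (κ : Fin d) :
    covLapSite W mu (x + (P : ℤ) • e κ) = covLapSite W mu x := by
  unfold covLapSite
  exact Finset.sum_congr rfl fun ν _ => cDstar_periodic hWP ν (cD_periodic hWP ν hmu) x κ

/-- **THE END's (1.38) IN DIVERGENCE FORM**: for a unitary `(N·Lᵏ)`-periodic background `W` and an `(N·Lᵏ)`-periodic END-framed direction `Z`,
`IsLandauB8 L N k W Z` iff the END-frame covariant divergence `covDiv W Z` is `ℓ²(periodBox)`-orthogonal (in `hsR`) to `Δ_W μ` for every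
`μ ∈ N(Q′(W))` — «R(U₀)D^{η*}_{U₀}A = 0» with `R(U₀)` the orthogonal projection onto `Δ_{U₀}N(Q′(U₀))` (B8 p. 80), modulo the projection itself.
[folklore] -/
theorem isLandauB8_iff_covDiv {L N k : ℕ} (hNL : 1 ≤ N * L ^ k) {W : Site d → Fin d → (Matrix n n ℂ)ˣ} (hWu : IsUnitaryCfg W)
    (hWP : IsPeriodicCfg W ((N * L ^ k : ℕ) : ℤ)) {Z : Site d → Fin d → Matrix n n ℂ} (hZ : IsPeriodicDir Z ((N * L ^ k : ℕ) : ℤ)) :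
    IsLandauB8 (d := d) L N k W Z ↔
      ∀ mu ∈ avgKernelGauges (d := d) (n := n) L N k W,
        ∑ x ∈ periodBox (d := d) (N * L ^ k), hsR (covDiv W Z x) (covLapSite W mu x) = 0 := by
  unfold IsLandauB8
  refine forall₂_congr fun mu hmu => ?_
  obtain ⟨-, hper, -⟩ := (mem_avgKernelGauges_iff (d := d) (n := n)).1 hmu
  rw [sum_hsR_gaugeDir hNL hWu hZ (covLapSite_periodic hWP hper)]

/-- **END-FRAME DIVERGENCE OF `Ad_{W⁻¹}Y` = START-FRAME DIVERGENCE OF `Y`**: `covDiv W (Ad_{W⁻¹}Y) x = cdiv W Y x`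
(`Σ_μ (Ad_{W(x,μ)}Ad_{W(x,μ)⁻¹}Y(x,μ) − Ad_{W(x−e_μ,μ)⁻¹}Y(x−e_μ,μ))`). [folklore] -/
theorem covDiv_AdInv_eq_cdiv (W : Site d → Fin d → (Matrix n n ℂ)ˣ) (Y : Site d → Fin d → Matrix n n ℂ) (x : Site d) :
    covDiv W (fun x μ => Ad (W x μ)⁻¹ (Y x μ)) x = cdiv W Y x := by
  unfold covDiv cdiv
  exact Finset.sum_congr rfl fun μ _ => by rw [Ad_Ad_inv]

/-- **(1.38) IN THE LEFT CHART**: for `Z = Ad_{W⁻¹}Y` (`Y = iηA`, `PairLeftChartB8`), `IsLandauB8 L N k W Z` iff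
`Σ_x hsR (cdiv W Y x) (Δ_W μ x) = 0` for all `μ ∈ N(Q′(W))` — «D^{η*}_{U₀}A ⊥ Δ_{U₀}N(Q′(U₀))». [folklore] -/
theorem isLandauB8_AdInv_iff_cdiv {L N k : ℕ} (hNL : 1 ≤ N * L ^ k) {W : Site d → Fin d → (Matrix n n ℂ)ˣ} (hWu : IsUnitaryCfg W)
    (hWP : IsPeriodicCfg W ((N * L ^ k : ℕ) : ℤ)) {Y : Site d → Fin d → Matrix n n ℂ} (hY : IsPeriodicDir Y ((N * L ^ k : ℕ) : ℤ)) :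
    IsLandauB8 (d := d) L N k W (fun x μ => Ad (W x μ)⁻¹ (Y x μ)) ↔
      ∀ mu ∈ avgKernelGauges (d := d) (n := n) L N k W,
        ∑ x ∈ periodBox (d := d) (N * L ^ k), hsR (cdiv W Y x) (covLapSite W mu x) = 0 := by
  have hZ : IsPeriodicDir (fun x μ => Ad (W x μ)⁻¹ (Y x μ)) ((N * L ^ k : ℕ) : ℤ) := by
    intro x κ μ
    simp only [hWP x κ μ, hY x κ μ]
  rw [isLandauB8_iff_covDiv hNL hWu hWP hZ]
  refine forall₂_congr fun mu _ => ?_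
  rw [Finset.sum_congr rfl fun x _ => by rw [covDiv_AdInv_eq_cdiv]]

end

end Summit.QuantumFields.BalabanUV.T4Continuum.NE3.PairLandauDivB8
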